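import Literature.Barriers.CriticalPhenomena.SupercriticalSAWSpaceFillingVolumeWindow
import HarnessLib

/-!
# Barrier mechanism, thirty-first audit: the free side of the near-critical window class is the
# CRITICAL LENGTH in disguise — tilt-negligible fugacity schedules are indistinguishable from
# `x_c`; LEFT windows are free up to the reciprocal of the critical length scale (tightness),
# two-sided windows up to the reciprocal rate of an exponential moment

Barrier catalogue `Literature/Barriers/CriticalPhenomena/` (D-0021); companion of
`SupercriticalSAWSpaceFillingProofs` (thirty-first audit, 2026-08-17, refuter, "barrier-audit"
gen 31, of the mechanism file `…Proofs` of `SupercriticalSAWSpaceFilling` = Theorem 1 of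
H. Duminil-Copin, G. Kozma, A. Yadin, *Supercritical self-avoiding walks are space-filling*,
Ann. IHP Probab. Stat. 50 (2014) 315–326, arXiv:1110.3074 — PROVED in the tree,
`SupercriticalSAWSpaceFilling_holds`; `blocks:` line unconditional,
`SupercriticalSAW.not_robustSAWScalingLimit`).

## What the audit found

1. **Page level (confirming).** Theorem 1 (p. 2 of arXiv:1110.3074, the weak space-filling
   sense of §1), Problems 9–10 and Conjecture 11 (p. 8) as vendored; one probe file on the farm,
   rc 0, 0 warnings: `SupercriticalSAWSpaceFilling` from `SupercriticalSAW.DKY2014_thm1_holds`,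
   the core lemma `SupercriticalSAW.IsSpaceFillingFamily.not_convergesInLawToSLE` with its
   hypothesis `hW` discharged by `isProjectiveLimit_preWienerMeasure_holds`,
   `SupercriticalSAW.not_sawScalingLimitAt_of_lt`, `SupercriticalSAW.not_robustSAWScalingLimit`,
   `SupercriticalSAW.sawScalingLimitAt_iff_of_pos`, `SupercriticalSAW.exists_closestSiteFamily`
   (no vacuity); axiom closures of the barrier fact, the core lemma and
   `not_robustSAWScalingLimit` = `propext`, `Classical.choice`, `Quot.sound`. Forward citations:
   27 in the local graph, 1 since 2024 on an API refresh (off-topic), newest mathematical one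
   Ann. Probab. 54 (2026) (quantitative sub-ballisticity AT `x_c`, hexagonal lattice); zbMATH
   "self-avoiding walk" 2026: 21 items, none on supercritical planar scaling limits or on
   Problem 10; broad discovery over the internal galaxy corpora: nothing beyond the held texts.
   The 66 route files of `Summits/CriticalPhenomena/SAWScalingLimit/Theses/` (28 naming the
   entry) pin the fugacity at the critical point of their model. Nothing evades the barrier.
2. **The one live class is the critical length in disguise (this file, proved).** The parent's
   `evasions_known` (i) leaves exactly one class "alive in substance and undecided by a theorem":
   fugacity windows `δ² ≪ w(δ) ≲ δ^{1/4}` (`O(δ²)` free, `…VolumeWindow`; `≥ δ^θ`, `θ < 1/4`,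
   blocked, `…WindowRateQuarter`, `…RightUniform`), with the remark that "for `w(δ)/δ² → ∞` the
   transfer needs a RATE of zero critical density". This file makes that remark exact and
   ONE-SIDED. The change of fugacity `x_c ↦ X(δ)` is a change of measure with density
   `ρ_δ = (X(δ)/x_c)^{|γ_δ|}` (`…VolumeWindow`), and the whole transfer is controlled by the
   **tilt defect** `E_{x_c,δ}|ρ_δ - 1|` ALONE: `|∫ g dP_{X(δ),δ} - ∫ g dP_{x_c,δ}| ≤ 4M E|ρ_δ - 1|`
   once the defect is `≤ 1/2` (`abs_integral_lawAt_sub_le_tiltDefect` — the prefactor `e^{N t}`,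
   `N = |Ω_δ|`, of `…Narrow`/`…VolumeWindow`, which is what stops at `O(δ²)`, is not needed).
   Hence (`IsTiltNegligible`): along a schedule with defect `→ 0` the laws are asymptotically
   equal in TOTAL VARIATION, so convergence in law to chordal SLE_κ for ANY `κ` (no SLE or
   zero-density input), weak space-filling / Problem 10 and every vanishing-probability
   conclusion are the same as at `x_c` (`IsTiltNegligible.convergesInLawToSLE_iff`,
   `….isSpaceFillingLaws_iff`, `….tendsto_measure_zero_iff`,
   `sawScalingLimitAlong_iff_of_isTiltNegligible`). And the defect is governed by the CRITICAL
   LENGTH: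
   * **LEFT** (`X ≤ x_c`): `ρ = e^{-t|γ|} ∈ (0, 1]`, `t = log x_c - log X`, so
     `E|ρ - 1| ≤ ε + P_{x_c}[t|γ_δ| ≥ ε]` (`integral_abs_fugacityTilt_sub_one_le_of_le`):
     TIGHTNESS of `w(δ)|γ_δ|` under the critical law is all that is needed — left windows
     `x_c - w(δ) ≤ X(δ) ≤ x_c` are free whenever `w(δ)|γ_δ| → 0` in `P_{x_c,δ}`-probability
     (`isTiltNegligible_of_left_window`, `sawScalingLimitAlong_iff_of_left_window`,
     `isSpaceFillingLaws_iff_of_left_window`); no rate, no large deviations;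
   * **EITHER SIDE**: `E|ρ - 1| ≤ (e^{Lt} - 1) + (e^{-(θ-t)L} + e^{-θL}) E_{x_c}[e^{θ|γ_δ|}]`
     (`integral_abs_fugacityTilt_sub_one_le_expMoment`), so ONE bounded exponential moment of
     the critical length at a rate `θ(δ)` frees every window `w(δ) = o(θ(δ))`
     (`isTiltNegligible_of_expMoment`, `…_of_window_expMoment`,
     `windowRobustSAWScalingLimit_iff_of_expMoment`); at `θ = δ²` the moment bound is free
     (`|γ_δ| ≤ |Ω_δ|`, `integral_exp_sq_mul_length_le`) and one recovers the sub-volume class of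
     `…Narrow` (`windowRobustSAWScalingLimit_iff_of_tendsto_div_sq`).
   READING for planners. The window class is not an independent door: on the left it is
   exactly as open as the tightness of the critical length one can prove (predicted scale
   `|γ_δ| ≍ δ^{-4/3}` [LSW04, Prediction 2], i.e. left windows `o(δ^{4/3})`; unconditionally
   only `|γ_δ| ≤ |Ω_δ| = O(δ⁻²)` — even zero critical density is open, cf. `…Density`), on the
   right as open as the exponential moments / large deviations of the critical length (the (LD)
   clause of `…Density`). At the scale `w ≍ δ^{4/3}` itself the tilt `e^{∓ s δ^{4/3}|γ_δ|}`
   does not degenerate and fugacity-robustness is expected to FAIL on both sides (a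
   non-trivial reweighting `∝ e^{∓ sU}` of the critical limit, `U` the rescaled length; on the
   left the massive / off-critical regime of [MS10, Questions 4.12–4.13]) — heuristic, by no
   declaration. The recorded classes of the parent are otherwise re-derived unchanged; no
   evasion found.

Outcome: **CONFIRMED at page level; the free side of the window clause is NARROWED to an
explicit criterion on the critical law** (`SupercriticalSAWSpaceFillingTiltWindow_holds`, axioms
`propext`, `Classical.choice`, `Quot.sound`). No new named fact.

## Formal content (all proved)

`abs_integral_lawAt_sub_le_tiltDefect` (the change of fugacity through the tilt defect),
`integral_abs_fugacityTilt_sub_one_le_of_le` (left moves: tightness bound),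
`integral_abs_fugacityTilt_sub_one_le_expMoment` (either side: exponential-moment bound),
`tiltDefect`, `tiltDefect_nonneg`, `IsTiltNegligible`, `isTiltNegligible_const`,
`IsTiltNegligible.tendsto_integral_sub`, `….tendsto_measureReal_sub`,
`….tendsto_measure_zero_iff`, `….isSpaceFillingLaws_iff`, `….convergesInLawToSLE_iff` (any `κ`),
`sawScalingLimitAlong_iff_of_isTiltNegligible`, `isTiltNegligible_of_left`,
`isTiltNegligible_of_left_window`, `sawScalingLimitAlong_iff_of_left_window`,
`isSpaceFillingLaws_iff_of_left_window`, `isTiltNegligible_of_expMoment`,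
`isTiltNegligible_of_window_expMoment`, `sawScalingLimitAlong_iff_of_window_expMoment`,
`windowRobustSAWScalingLimit_iff_of_expMoment`, `integral_lawAt_le_of_le`,
`integral_exp_sq_mul_length_le`, `windowRobustSAWScalingLimit_iff_of_tendsto_div_sq`; the closed
`Prop` `SupercriticalSAWSpaceFillingTiltWindow` with `…_holds`.

Mathlib: `MeasureTheory.integral_mono`, `integral_indicator_one`, `abs_integral_le_integral_abs`,
`ENNReal.tendsto_toReal_iff`, `squeeze_zero'`, `Real.tendsto_exp_neg_atTop_nhds_zero`,
`Real.add_one_le_exp`, `Metric.tendsto_nhds`.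

## References

* H. Duminil-Copin, G. Kozma, A. Yadin, Ann. IHP Probab. Stat. 50 (2014) 315–326,
  arXiv:1110.3074: p. 2 (§1: the law `P_{(Ω_δ,a_δ,b_δ,x)}`, the weak sense of space-filling;
  Theorem 1), p. 8 (Problems 9–10, Conjecture 11). [DuminilCopinKozmaYadin2014]
* G. F. Lawler, O. Schramm, W. Werner, *On the scaling limit of planar self-avoiding walk*
  (2004), arXiv:math/0204277, Prediction 2 (`ν = 3/4`; the crossover `δ^{4/3}`).
  [LawlerSchrammWerner2004SAW]
* N. Makarov, S. Smirnov, *Off-critical lattice models and massive SLEs* (2010), Questions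
  4.12–4.13. [MakarovSmirnov2010]
* C. J. Bradly, A. L. Owczarek, Phys. Rev. E (2021): the finite-size variable
  `(β - β_c)L^{4/3}` for fugacity-weighted walks in a box. [BradlyOwczarek2021]
* P. Billingsley, *Convergence of probability measures*, 2nd ed. (1999), Thm 2.1. [Billingsley1999]
-/
noncomputable section

open MeasureTheory Filter Topology Metric Set Literature.Probability.LatticeModels
  Literature.Probability.Percolation Literature.Probability.RandomPlanarGeometry
  Literature.Probability.RandomPlanarGeometry.SAW
open scoped ENNReal NNReal BoundedContinuousFunction

namespace Literature.Barriers.CriticalPhenomena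

namespace SupercriticalSAW

/-! ### The tilt defect `E_x|(y/x)^{|γ|} - 1|` controls the change of fugacity -/

section TiltDefect

variable {Ω : Set ℂ} {δ : ℝ} {a b : Site 2}

/-- **The change of fugacity is controlled by the tilt defect alone.** For `x, y > 0`, walks of
bounded length and `g` bounded by `M ≥ 0`: if `E_x|(y/x)^{|γ|} - 1| ≤ 1/2` then
`|∫ g dP_y - ∫ g dP_x| ≤ 4M · E_x|(y/x)^{|γ|} - 1|` (no factor `e^{N t}`: compare
`abs_integral_lawAt_sub_le_of_length`). Proof: `P_y` is `P_x` tilted by `ρ = (y/x)^{|γ|}`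
(`integral_lawAt_eq_div`), `∫ g dP_y - ∫ g dP_x = (E_x[ρ g] - E_x[g] E_x[ρ])/E_x[ρ]`, the
numerator is at most `2M E_x|ρ - 1|` in absolute value and `E_x[ρ] ≥ 1 - E_x|ρ - 1| ≥ 1/2`.
[folklore] -/
theorem abs_integral_lawAt_sub_le_tiltDefect {x y : ℝ} (hx : 0 < x) (hy : 0 < y) {N : ℕ}
    (hN : ∀ γ : DomainSAW Ω δ a b, γ.length ≤ N) (g : DomainSAW Ω δ a b → ℝ)
    {M : ℝ} (hM0 : 0 ≤ M) (hM : ∀ γ, |g γ| ≤ M)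
    (hD : ∫ γ, |((fugacityTilt x y γ : ℝ≥0) : ℝ) - 1| ∂lawAt x Ω δ a b ≤ 1 / 2) :
    |∫ γ, g γ ∂lawAt y Ω δ a b - ∫ γ, g γ ∂lawAt x Ω δ a b| ≤
      4 * M * ∫ γ, |((fugacityTilt x y γ : ℝ≥0) : ℝ) - 1| ∂lawAt x Ω δ a b := by
  set t := |Real.log y - Real.log x| with ht
  rcases lawAt_eq_zero_or_isProbabilityMeasure x Ω δ a b with h0 | hP
  · -- junk: both laws vanish
    rw [lawAt_eq_zero_of_lawAt_eq_zero hx hy hN h0, h0]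
    simp
  haveI := hP
  set P := lawAt x Ω δ a b with hPdef
  set ρ : DomainSAW Ω δ a b → ℝ := fun γ => (fugacityTilt x y γ : ℝ) with hρ
  have hρle : ∀ γ, ρ γ ≤ Real.exp (N * t) := fun γ => (exp_neg_le_fugacityTilt hx hy (hN γ)).2
  have hρabs : ∀ γ, |ρ γ - 1| ≤ Real.exp (N * t) := fun γ =>
    abs_fugacityTilt_sub_one_le_exp hx hy (hN γ)
  -- integrability (everything is bounded)
  have hint_ρ : Integrable ρ P := integrable_lawAt_of_abs_le x ρ fun γ => by
    simp only [hρ]; rw [abs_of_nonneg (fugacityTilt x y γ).coe_nonneg]; exact hρle γ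
  have hint_g : Integrable g P := integrable_lawAt_of_abs_le x g hM
  have hint_ρg : Integrable (fun γ => ρ γ * g γ) P :=
    integrable_lawAt_of_abs_le x _ (M := Real.exp (N * t) * M) fun γ => by
      rw [abs_mul]
      simp only [hρ]
      rw [abs_of_nonneg (fugacityTilt x y γ).coe_nonneg]
      exact mul_le_mul (hρle γ) (hM γ) (abs_nonneg _) (Real.exp_pos _).le
  have hint_ρ1 : Integrable (fun γ => |ρ γ - 1|) P :=
    integrable_lawAt_of_abs_le x _ (M := Real.exp (N * t)) fun γ => by
      rw [abs_abs]; exact hρabs γ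
  have hint_d : Integrable (fun γ => (ρ γ - 1) * g γ) P :=
    integrable_lawAt_of_abs_le x _ (M := Real.exp (N * t) * M) fun γ => by
      rw [abs_mul]
      exact mul_le_mul (hρabs γ) (hM γ) (abs_nonneg _) (Real.exp_pos _).le
  -- the integrals
  set I0 := ∫ γ, ρ γ ∂P with hI0def
  set I1 := ∫ γ, ρ γ * g γ ∂P with hI1def
  set J := ∫ γ, g γ ∂P with hJdef
  set E := ∫ γ, |ρ γ - 1| ∂P with hEdef
  have hE0 : 0 ≤ E := integral_nonneg fun γ => abs_nonneg _
  -- `I0 ≥ 1 - E ≥ 1/2`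
  have hI0 : 1 - E ≤ I0 := by
    have e2 : ∫ γ, (ρ γ - 1) ∂P = I0 - 1 := by
      rw [integral_sub hint_ρ (integrable_const 1)]
      simp [hI0def]
    have h1 : |∫ γ, (ρ γ - 1) ∂P| ≤ E := abs_integral_le_integral_abs
    rw [e2] at h1
    linarith [neg_abs_le (I0 - 1)]
  have hI0pos : 0 < I0 := by linarith
  have hJ : |J| ≤ M := by
    have h1 : |J| ≤ ∫ γ, |g γ| ∂P := abs_integral_le_integral_abs
    have h2 : ∫ γ, |g γ| ∂P ≤ ∫ _γ, M ∂P := integral_mono hint_g.abs (integrable_const M) hM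
    have h3 : ∫ _γ, M ∂P = M := by simp
    linarith
  -- `∫ g dP_y = I1/I0` and `|I1 - J I0| ≤ 2M E`
  have hy_int : ∫ γ, g γ ∂lawAt y Ω δ a b = I1 / I0 := integral_lawAt_eq_div hx hy hP hN g
  have hkey : I1 - J * I0 = ∫ γ, (ρ γ - 1) * g γ ∂P - J * ∫ γ, (ρ γ - 1) ∂P := by
    have e1 : ∫ γ, (ρ γ - 1) * g γ ∂P = I1 - J := by
      have : (fun γ => (ρ γ - 1) * g γ) = fun γ => ρ γ * g γ - g γ := by ext γ; ring
      rw [this, integral_sub hint_ρg hint_g]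
    have e2 : ∫ γ, (ρ γ - 1) ∂P = I0 - 1 := by
      rw [integral_sub hint_ρ (integrable_const 1)]
      simp [hI0def]
    rw [e1, e2]; ring
  have hb1 : |∫ γ, (ρ γ - 1) * g γ ∂P| ≤ M * E := by
    calc |∫ γ, (ρ γ - 1) * g γ ∂P| ≤ ∫ γ, |(ρ γ - 1) * g γ| ∂P := abs_integral_le_integral_abs
      _ ≤ ∫ γ, M * |ρ γ - 1| ∂P := by
          refine integral_mono hint_d.abs (hint_ρ1.const_mul M) fun γ => ?_
          show |(ρ γ - 1) * g γ| ≤ M * |ρ γ - 1|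
          rw [abs_mul, mul_comm]
          exact mul_le_mul_of_nonneg_right (hM γ) (abs_nonneg _)
      _ = M * E := integral_const_mul _ _
  have hb2 : |∫ γ, (ρ γ - 1) ∂P| ≤ E := abs_integral_le_integral_abs
  have hdiff : |I1 - J * I0| ≤ 2 * M * E := by
    rw [hkey]
    calc |∫ γ, (ρ γ - 1) * g γ ∂P - J * ∫ γ, (ρ γ - 1) ∂P|
        ≤ |∫ γ, (ρ γ - 1) * g γ ∂P| + |J * ∫ γ, (ρ γ - 1) ∂P| := abs_sub _ _
      _ ≤ M * E + M * E := by
          refine add_le_add hb1 ?_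
          rw [abs_mul]
          exact mul_le_mul hJ hb2 (abs_nonneg _) hM0
      _ = 2 * M * E := by ring
  -- conclusion
  rw [hy_int]
  have e : I1 / I0 - J = (I1 - J * I0) / I0 := by field_simp
  rw [e, abs_div, abs_of_pos hI0pos, div_le_iff₀ hI0pos]
  have hhalf : 1 / 2 ≤ I0 := by linarith
  calc |I1 - J * I0| ≤ 2 * M * E := hdiff
    _ = 4 * M * E * (1 / 2) := by ring
    _ ≤ 4 * M * E * I0 := mul_le_mul_of_nonneg_left hhalf (by positivity)

/-- **Tilt defect of a LEFT move (`y ≤ x`): tightness of the length is all that matters.** For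
`0 < y ≤ x` the tilt `(y/x)^{|γ|} = e^{-t|γ|}`, `t = log x - log y ≥ 0`, lies in `(0, 1]`, so
`|(y/x)^{|γ|} - 1| ≤ min(1, t|γ|)` and, for every `ε ≥ 0`,
`E_x|(y/x)^{|γ|} - 1| ≤ ε + P_x[t |γ| ≥ ε]`. [folklore] -/
theorem integral_abs_fugacityTilt_sub_one_le_of_le {x y : ℝ} (hy : 0 < y) (hyx : y ≤ x)
    {ε : ℝ} (hε : 0 ≤ ε) :
    ∫ γ, |((fugacityTilt x y γ : ℝ≥0) : ℝ) - 1| ∂lawAt x Ω δ a b ≤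
      ε + (lawAt x Ω δ a b
        {γ | ε ≤ (Real.log x - Real.log y) * (γ.length : ℝ)}).toReal := by
  have hx : 0 < x := hy.trans_le hyx
  set t := Real.log x - Real.log y with ht
  have ht0 : 0 ≤ t := sub_nonneg.2 (Real.log_le_log hy hyx)
  set B : Set (DomainSAW Ω δ a b) := {γ | ε ≤ t * (γ.length : ℝ)} with hB
  have hmeasB : MeasurableSet B := MeasurableSpace.measurableSet_top
  -- pointwise: `|ρ - 1| ≤ ε + 1_B`
  have hpt : ∀ γ : DomainSAW Ω δ a b,
      |((fugacityTilt x y γ : ℝ≥0) : ℝ) - 1| ≤ ε + B.indicator (1 : DomainSAW Ω δ a b → ℝ) γ := by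
    intro γ
    have hρ : ((fugacityTilt x y γ : ℝ≥0) : ℝ) = Real.exp (-(t * γ.length)) := by
      rw [coe_fugacityTilt_eq_exp hx hy]; congr 1; rw [ht]; ring
    have hu0 : 0 ≤ t * γ.length := mul_nonneg ht0 (Nat.cast_nonneg _)
    have hρle1 : Real.exp (-(t * γ.length)) ≤ 1 := Real.exp_le_one_iff.2 (by linarith)
    have hρpos : 0 < Real.exp (-(t * γ.length)) := Real.exp_pos _
    rw [hρ, abs_of_nonpos (by linarith)]
    by_cases hγ : γ ∈ B
    · rw [indicator_of_mem hγ, Pi.one_apply]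
      linarith
    · rw [indicator_of_notMem hγ, add_zero]
      have hlt : t * γ.length < ε := not_le.1 hγ
      -- `1 - e^{-u} ≤ u`
      have h1 : 1 - (t * γ.length) ≤ Real.exp (-(t * γ.length)) := by
        have := Real.add_one_le_exp (-(t * γ.length)); linarith
      linarith
  rcases lawAt_eq_zero_or_isProbabilityMeasure x Ω δ a b with h0 | hP
  · rw [h0]; simp [hε]
  haveI := hP
  have hint_ind : Integrable (fun γ => B.indicator (1 : DomainSAW Ω δ a b → ℝ) γ) (lawAt x Ω δ a b) :=
    (integrable_const (1 : ℝ)).indicator hmeasB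
  have hint_l : Integrable (fun γ => |((fugacityTilt x y γ : ℝ≥0) : ℝ) - 1|) (lawAt x Ω δ a b) :=
    integrable_lawAt_of_abs_le x _ (M := ε + 1) fun γ => by
      rw [abs_abs]
      refine (hpt γ).trans (add_le_add le_rfl ?_)
      by_cases hγ : γ ∈ B
      · rw [indicator_of_mem hγ, Pi.one_apply]
      · rw [indicator_of_notMem hγ]; exact zero_le_one
  have hint_rhs : Integrable (fun γ => ε + B.indicator (1 : DomainSAW Ω δ a b → ℝ) γ) (lawAt x Ω δ a b) :=
    (integrable_const ε).add hint_ind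
  have h : ∫ γ, |((fugacityTilt x y γ : ℝ≥0) : ℝ) - 1| ∂lawAt x Ω δ a b ≤
      ∫ γ, (ε + B.indicator (1 : DomainSAW Ω δ a b → ℝ) γ) ∂lawAt x Ω δ a b :=
    integral_mono hint_l hint_rhs hpt
  have e : ∫ γ, (ε + B.indicator (1 : DomainSAW Ω δ a b → ℝ) γ) ∂lawAt x Ω δ a b =
      ε + (lawAt x Ω δ a b B).toReal := by
    rw [integral_add (integrable_const ε) hint_ind, integral_indicator_one hmeasB, measureReal_def]
    simp
  linarith

/-- **Tilt defect under an exponential moment (either side).** For `x, y > 0`,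
`t = |log y - log x| ≤ θ` and `L ≥ 0`:
`E_x|(y/x)^{|γ|} - 1| ≤ (e^{L t} - 1) + (e^{-(θ - t) L} + e^{-θ L}) · E_x[e^{θ |γ|}]` — on
`{|γ| < L}` the tilt is within `e^{Lt} - 1` of `1`, on `{|γ| ≥ L}` one has
`|ρ - 1| ≤ ρ + 1 ≤ e^{θ|γ|} (e^{-(θ-t)L} + e^{-θ L})`. [folklore] -/
theorem integral_abs_fugacityTilt_sub_one_le_expMoment {x y : ℝ} (hx : 0 < x) (hy : 0 < y)
    {N : ℕ} (hN : ∀ γ : DomainSAW Ω δ a b, γ.length ≤ N)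
    {θ L : ℝ} (hθ : |Real.log y - Real.log x| ≤ θ) (hL : 0 ≤ L) :
    ∫ γ, |((fugacityTilt x y γ : ℝ≥0) : ℝ) - 1| ∂lawAt x Ω δ a b ≤
      (Real.exp (L * |Real.log y - Real.log x|) - 1) +
        (Real.exp (-((θ - |Real.log y - Real.log x|) * L)) + Real.exp (-(θ * L))) *
          ∫ γ, Real.exp (θ * γ.length) ∂lawAt x Ω δ a b := by
  set t := |Real.log y - Real.log x| with ht
  have ht0 : 0 ≤ t := abs_nonneg _
  have hθ0 : 0 ≤ θ := ht0.trans hθ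
  set c : ℝ := Real.exp (-((θ - t) * L)) + Real.exp (-(θ * L)) with hc
  have hc0 : 0 ≤ c := by positivity
  have hL1 : 0 ≤ Real.exp (L * t) - 1 := by
    have := Real.one_le_exp (mul_nonneg hL ht0); linarith
  -- pointwise bound
  have hpt : ∀ γ : DomainSAW Ω δ a b,
      |((fugacityTilt x y γ : ℝ≥0) : ℝ) - 1| ≤ (Real.exp (L * t) - 1) + c * Real.exp (θ * γ.length) := by
    intro γ
    have hn0 : (0 : ℝ) ≤ γ.length := Nat.cast_nonneg _
    have heθ : 0 ≤ c * Real.exp (θ * γ.length) := by positivity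
    by_cases hγ : (γ.length : ℝ) < L
    · have h1 := abs_fugacityTilt_sub_one_le hx hy hγ.le
      rw [← ht] at h1
      linarith
    · have hγL : L ≤ (γ.length : ℝ) := not_lt.1 hγ
      have hρ : ((fugacityTilt x y γ : ℝ≥0) : ℝ) = Real.exp (γ.length * (Real.log y - Real.log x)) :=
        coe_fugacityTilt_eq_exp hx hy γ
      have hρle : ((fugacityTilt x y γ : ℝ≥0) : ℝ) ≤ Real.exp (t * γ.length) := by
        rw [hρ, Real.exp_le_exp]
        calc (γ.length : ℝ) * (Real.log y - Real.log x) ≤ γ.length * t :=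
              mul_le_mul_of_nonneg_left (le_abs_self _) hn0
          _ = t * γ.length := mul_comm _ _
      have hρ0 : 0 ≤ ((fugacityTilt x y γ : ℝ≥0) : ℝ) := (fugacityTilt x y γ).coe_nonneg
      -- `|ρ - 1| ≤ ρ + 1`
      have hab : |((fugacityTilt x y γ : ℝ≥0) : ℝ) - 1| ≤ ((fugacityTilt x y γ : ℝ≥0) : ℝ) + 1 := by
        rw [abs_le]; constructor <;> linarith
      -- `ρ ≤ e^{θ n} e^{-(θ-t)L}` and `1 ≤ e^{θ n} e^{-θ L}`
      have h2 : Real.exp (t * γ.length) ≤ Real.exp (θ * γ.length) * Real.exp (-((θ - t) * L)) := by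
        rw [← Real.exp_add, Real.exp_le_exp]
        nlinarith [mul_le_mul_of_nonneg_left hγL (sub_nonneg.2 hθ)]
      have h3 : (1 : ℝ) ≤ Real.exp (θ * γ.length) * Real.exp (-(θ * L)) := by
        rw [← Real.exp_add]
        refine Real.one_le_exp ?_
        nlinarith [mul_le_mul_of_nonneg_left hγL hθ0]
      calc |((fugacityTilt x y γ : ℝ≥0) : ℝ) - 1| ≤ ((fugacityTilt x y γ : ℝ≥0) : ℝ) + 1 := hab
        _ ≤ Real.exp (θ * γ.length) * Real.exp (-((θ - t) * L)) +
              Real.exp (θ * γ.length) * Real.exp (-(θ * L)) := add_le_add (hρle.trans h2) h3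
        _ = c * Real.exp (θ * γ.length) := by rw [hc]; ring
        _ ≤ (Real.exp (L * t) - 1) + c * Real.exp (θ * γ.length) := by linarith
  rcases lawAt_eq_zero_or_isProbabilityMeasure x Ω δ a b with h0 | hP
  · rw [h0]; simp [hL1]
  haveI := hP
  have hexp_bd : ∀ γ : DomainSAW Ω δ a b, |Real.exp (θ * γ.length)| ≤ Real.exp (θ * N) := fun γ => by
    rw [abs_of_pos (Real.exp_pos _), Real.exp_le_exp]
    exact mul_le_mul_of_nonneg_left (by exact_mod_cast hN γ) hθ0
  have hint_e : Integrable (fun γ : DomainSAW Ω δ a b => Real.exp (θ * γ.length)) (lawAt x Ω δ a b) :=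
    integrable_lawAt_of_abs_le x _ hexp_bd
  have hint_rhs : Integrable (fun γ : DomainSAW Ω δ a b =>
      (Real.exp (L * t) - 1) + c * Real.exp (θ * γ.length)) (lawAt x Ω δ a b) :=
    (integrable_const _).add (hint_e.const_mul c)
  have hint_l : Integrable (fun γ => |((fugacityTilt x y γ : ℝ≥0) : ℝ) - 1|) (lawAt x Ω δ a b) :=
    integrable_lawAt_of_abs_le x _ (M := (Real.exp (L * t) - 1) + c * Real.exp (θ * N)) fun γ => by
      rw [abs_abs]
      refine (hpt γ).trans (add_le_add le_rfl ?_)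
      exact mul_le_mul_of_nonneg_left ((le_abs_self _).trans (hexp_bd γ)) hc0
  have h : ∫ γ, |((fugacityTilt x y γ : ℝ≥0) : ℝ) - 1| ∂lawAt x Ω δ a b ≤
      ∫ γ : DomainSAW Ω δ a b, ((Real.exp (L * t) - 1) + c * Real.exp (θ * γ.length)) ∂lawAt x Ω δ a b :=
    integral_mono hint_l hint_rhs hpt
  have e : ∫ γ : DomainSAW Ω δ a b, ((Real.exp (L * t) - 1) + c * Real.exp (θ * γ.length)) ∂lawAt x Ω δ a b
      = (Real.exp (L * t) - 1) + c * ∫ γ : DomainSAW Ω δ a b, Real.exp (θ * γ.length) ∂lawAt x Ω δ a b := by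
    rw [integral_add (integrable_const _) (hint_e.const_mul c), integral_const_mul]
    simp
  linarith

end TiltDefect

/-! ### Tilt-negligible schedules: indistinguishable from `x_c` -/

section Schedule

variable {Ω : Set ℂ} {A B : ℝ → Site 2}

/-- The **tilt defect** of the fugacity schedule `X` at mesh `δ` in `(Ω_δ; A δ, B δ)`:
`E_{x_c,δ}|(X(δ)/x_c)^{|γ_δ|} - 1|`, the `L¹(P_{x_c,δ})`-distance between the Radon–Nikodym
factor of `P_{X(δ),δ}` against the critical law and `1`. [folklore] -/
def tiltDefect (X : ℝ → ℝ) (Ω : Set ℂ) (A B : ℝ → Site 2) (δ : ℝ) : ℝ :=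
  ∫ γ, |((fugacityTilt criticalFugacity (X δ) γ : ℝ≥0) : ℝ) - 1| ∂law Ω δ (A δ) (B δ)

/-- The tilt defect is non-negative. [folklore] -/
theorem tiltDefect_nonneg (X : ℝ → ℝ) (Ω : Set ℂ) (A B : ℝ → Site 2) (δ : ℝ) :
    0 ≤ tiltDefect X Ω A B δ :=
  integral_nonneg fun _ => abs_nonneg _

/-- A **tilt-negligible** fugacity schedule in `(Ω; A, B)`: eventually positive, with tilt
defect against the critical laws tending to `0` as `δ → 0⁺`. [folklore] -/
def IsTiltNegligible (X : ℝ → ℝ) (Ω : Set ℂ) (A B : ℝ → Site 2) : Prop :=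
  (∀ᶠ δ in 𝓝[>] (0 : ℝ), 0 < X δ) ∧ Tendsto (tiltDefect X Ω A B) (𝓝[>] 0) (𝓝 0)

/-- The critical schedule itself is tilt-negligible (defect `0`). [folklore] -/
theorem isTiltNegligible_const : IsTiltNegligible (fun _ => criticalFugacity) Ω A B := by
  obtain ⟨hxc, -⟩ := criticalFugacity_pos_lt_one'
  refine ⟨Eventually.of_forall fun _ => hxc, ?_⟩
  have h0 : tiltDefect (fun _ => criticalFugacity) Ω A B = fun _ => 0 := by
    funext δ
    simp only [tiltDefect]
    have : ∀ γ : DomainSAW Ω δ (A δ) (B δ),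
        |((fugacityTilt criticalFugacity criticalFugacity γ : ℝ≥0) : ℝ) - 1| = 0 := fun γ => by
      rw [coe_fugacityTilt hxc hxc, div_self hxc.ne', one_pow, sub_self, abs_zero]
    simp [this]
  rw [h0]
  exact tendsto_const_nhds

/-- **Tilt-negligible schedules carry the same bounded expectations as the critical laws**:
`∫ g_δ dP_{X(δ),δ} - ∫ g_δ dP_{x_c,δ} → 0` for every uniformly bounded family `g_δ` (bounded
domain). [folklore] -/
theorem IsTiltNegligible.tendsto_integral_sub {X : ℝ → ℝ} (h : IsTiltNegligible X Ω A B)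
    (hΩ : Bornology.IsBounded Ω) (g : ∀ δ : ℝ, DomainSAW Ω δ (A δ) (B δ) → ℝ) {M : ℝ}
    (hM0 : 0 ≤ M) (hM : ∀ δ γ, |g δ γ| ≤ M) :
    Tendsto (fun δ => ∫ γ, g δ γ ∂lawAt (X δ) Ω δ (A δ) (B δ) - ∫ γ, g δ γ ∂law Ω δ (A δ) (B δ))
      (𝓝[>] 0) (𝓝 0) := by
  obtain ⟨hxc, -⟩ := criticalFugacity_pos_lt_one'
  obtain ⟨hX, hT⟩ := h
  have hhalf : ∀ᶠ δ in 𝓝[>] (0 : ℝ), tiltDefect X Ω A B δ ≤ 1 / 2 :=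
    hT.eventually (Iic_mem_nhds (by norm_num : (0 : ℝ) < 1 / 2))
  have hbound : ∀ᶠ δ in 𝓝[>] (0 : ℝ),
      |∫ γ, g δ γ ∂lawAt (X δ) Ω δ (A δ) (B δ) - ∫ γ, g δ γ ∂law Ω δ (A δ) (B δ)| ≤
        4 * M * tiltDefect X Ω A B δ := by
    filter_upwards [hX, hhalf, self_mem_nhdsWithin] with δ hXδ hδ hδ0
    have hlen : ∀ γ : DomainSAW Ω δ (A δ) (B δ), γ.length ≤ (meshDomain Ω δ).ncard := fun γ =>
      length_le_ncard_meshDomain (meshDomain_finite hΩ (mem_Ioi.1 hδ0)) γ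
    rw [← lawAt_criticalFugacity]
    exact abs_integral_lawAt_sub_le_tiltDefect hxc hXδ hlen (g δ) hM0 (hM δ) hδ
  rw [tendsto_zero_iff_abs_tendsto_zero]
  refine squeeze_zero' (Eventually.of_forall fun δ => abs_nonneg _) hbound ?_
  simpa using hT.const_mul (4 * M)

/-- **Probabilities of arbitrary events differ by `o(1)` along a tilt-negligible schedule**
(asymptotic equivalence in total variation). [folklore] -/
theorem IsTiltNegligible.tendsto_measureReal_sub {X : ℝ → ℝ} (h : IsTiltNegligible X Ω A B)
    (hΩ : Bornology.IsBounded Ω) (E : ∀ δ : ℝ, Set (DomainSAW Ω δ (A δ) (B δ))) :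
    Tendsto (fun δ => (lawAt (X δ) Ω δ (A δ) (B δ) (E δ)).toReal - (law Ω δ (A δ) (B δ) (E δ)).toReal)
      (𝓝[>] 0) (𝓝 0) := by
  have hmeas : ∀ δ, MeasurableSet (E δ) := fun δ => MeasurableSpace.measurableSet_top
  have key := h.tendsto_integral_sub hΩ
    (fun δ γ => (E δ).indicator (1 : DomainSAW Ω δ (A δ) (B δ) → ℝ) γ) zero_le_one fun δ γ => by
      by_cases hγ : γ ∈ E δ
      · rw [indicator_of_mem hγ, Pi.one_apply, abs_one]
      · rw [indicator_of_notMem hγ, abs_zero]; exact zero_le_one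
  refine key.congr' (Eventually.of_forall fun δ => ?_)
  simp only [integral_indicator_one (hmeas δ), measureReal_def]

/-- **Vanishing probabilities are the same along a tilt-negligible schedule as at `x_c`.**
[folklore] -/
theorem IsTiltNegligible.tendsto_measure_zero_iff {X : ℝ → ℝ} (h : IsTiltNegligible X Ω A B)
    (hΩ : Bornology.IsBounded Ω) (E : ∀ δ : ℝ, Set (DomainSAW Ω δ (A δ) (B δ))) :
    Tendsto (fun δ => lawAt (X δ) Ω δ (A δ) (B δ) (E δ)) (𝓝[>] 0) (𝓝 0) ↔
      Tendsto (fun δ => law Ω δ (A δ) (B δ) (E δ)) (𝓝[>] 0) (𝓝 0) := by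
  have hd := h.tendsto_measureReal_sub hΩ E
  have e1 : ∀ δ, lawAt (X δ) Ω δ (A δ) (B δ) (E δ) ≠ ∞ := fun δ => measure_ne_top _ _
  have e2 : ∀ δ, law Ω δ (A δ) (B δ) (E δ) ≠ ∞ := fun δ => measure_ne_top _ _
  rw [← ENNReal.tendsto_toReal_iff e1 ENNReal.zero_ne_top,
    ← ENNReal.tendsto_toReal_iff e2 ENNReal.zero_ne_top, ENNReal.toReal_zero]
  constructor
  · intro h1
    have := h1.sub hd
    simpa using this
  · intro h2
    have := h2.add hd
    simpa using this

/-- **Weak space-filling (hence Problem 10) is the same along a tilt-negligible schedule as at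
`x_c`.** [cite: DuminilCopinKozmaYadin2014, §1 (When x > 1/μ) and Problem 10] -/
theorem IsTiltNegligible.isSpaceFillingLaws_iff {X : ℝ → ℝ} (h : IsTiltNegligible X Ω A B)
    (hΩ : Bornology.IsBounded Ω) :
    IsSpaceFillingLaws Ω A B (fun δ => lawAt (X δ) Ω δ (A δ) (B δ)) ↔
      IsSpaceFillingFamily criticalFugacity Ω A B := by
  refine forall₄_congr fun U _ _ _ => ?_
  exact h.tendsto_measure_zero_iff hΩ fun δ => {γ | ∀ v ∈ γ.walk.support, meshPoint δ v ∉ U}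

/-- **Convergence in law to chordal SLE_κ — ANY `κ` — is the same along a tilt-negligible
schedule as at `x_c`** (no zero-density or SLE input: compare `convergesInLawToSLE_volume_iff`,
which needs `κ ≤ 4`). [folklore] -/
theorem IsTiltNegligible.convergesInLawToSLE_iff {X : ℝ → ℝ} {D : DobrushinDomain}
    (h : IsTiltNegligible X D.carrier A B) (κ : ℝ≥0) :
    ConvergesInLawToSLE κ D (fun δ (γ : DomainSAW D.carrier δ (A δ) (B δ)) => γ.curve)
        (fun δ => lawAt (X δ) D.carrier δ (A δ) (B δ)) ↔
      ConvergesInLawToSLE κ D (fun δ (γ : DomainSAW D.carrier δ (A δ) (B δ)) => γ.curve)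
        (fun δ => law D.carrier δ (A δ) (B δ)) := by
  have hmeas : ∀ (P : ∀ δ : ℝ, Measure (DomainSAW D.carrier δ (A δ) (B δ))),
      ∀ᶠ δ in 𝓝[>] (0 : ℝ),
        AEMeasurable (fun γ : DomainSAW D.carrier δ (A δ) (B δ) => γ.curve) (P δ) :=
    fun P => Eventually.of_forall fun δ => (DomainSAW.measurable_of_top _).aemeasurable
  have hdiff : ∀ f : CurveClass ℂ →ᵇ ℝ,
      Tendsto (fun δ => ∫ γ, f γ.curve ∂lawAt (X δ) D.carrier δ (A δ) (B δ) -
        ∫ γ, f γ.curve ∂law D.carrier δ (A δ) (B δ)) (𝓝[>] 0) (𝓝 0) := fun f =>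
    h.tendsto_integral_sub D.isBounded (fun δ γ => f γ.curve) (norm_nonneg f) fun δ γ => by
      rw [← Real.norm_eq_abs]; exact f.norm_coe_le_norm _
  constructor
  · rintro ⟨Γ, hΓ, -, hT⟩
    refine ⟨Γ, hΓ, hmeas _, fun f => ?_⟩
    have := (hT f).sub (hdiff f)
    simpa using this
  · rintro ⟨Γ, hΓ, -, hT⟩
    refine ⟨Γ, hΓ, hmeas _, fun f => ?_⟩
    have := (hT f).add (hdiff f)
    simpa using this

/-- **Along a schedule tilt-negligible in every Dobrushin domain the SLE_{8/3} statement is the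
sub-problem.** [folklore] -/
theorem sawScalingLimitAlong_iff_of_isTiltNegligible {X : ℝ → ℝ}
    (h : ∀ (D : DobrushinDomain) (A B : ℝ → Site 2), IsEndpointApprox D A B →
      IsTiltNegligible X D.carrier A B) :
    SAWScalingLimitAlong X ↔ SAWScalingLimit :=
  forall₄_congr fun D a b hab => (h D a b hab).convergesInLawToSLE_iff _

end Schedule

/-! ### LEFT schedules: tightness of the critical length is the whole story -/

section Left

variable {Ω : Set ℂ} {A B : ℝ → Site 2}

/-- **Left criterion.** A schedule `0 < X(δ) ≤ x_c` is tilt-negligible in `(Ω; A, B)` as soon as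
`t(δ)|γ_δ| → 0` in `P_{x_c,δ}`-probability, `t(δ) = log x_c - log X(δ)`: for a left move the
tilt `e^{-t|γ|}` is at most `1`, so no large-deviation input is needed
(`integral_abs_fugacityTilt_sub_one_le_of_le`). [folklore] -/
theorem isTiltNegligible_of_left {X : ℝ → ℝ}
    (hX : ∀ᶠ δ in 𝓝[>] (0 : ℝ), 0 < X δ ∧ X δ ≤ criticalFugacity)
    (hlen : ∀ ε : ℝ, 0 < ε → Tendsto (fun δ => law Ω δ (A δ) (B δ)
        {γ | ε ≤ (Real.log criticalFugacity - Real.log (X δ)) * (γ.length : ℝ)}) (𝓝[>] 0) (𝓝 0)) :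
    IsTiltNegligible X Ω A B := by
  refine ⟨hX.mono fun δ h => h.1, ?_⟩
  rw [Metric.tendsto_nhds]
  intro ε hε
  have h2 := (ENNReal.tendsto_toReal ENNReal.zero_ne_top).comp (hlen (ε / 2) (half_pos hε))
  rw [ENNReal.toReal_zero] at h2
  filter_upwards [hX, h2.eventually (Iio_mem_nhds (half_pos hε))] with δ hXδ hδ
  rw [Real.dist_eq, sub_zero, abs_of_nonneg (tiltDefect_nonneg X Ω A B δ)]
  have key := integral_abs_fugacityTilt_sub_one_le_of_le (Ω := Ω) (δ := δ) (a := A δ) (b := B δ)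
    hXδ.1 hXδ.2 (half_pos hε).le
  rw [lawAt_criticalFugacity] at key
  calc tiltDefect X Ω A B δ ≤ ε / 2 + (law Ω δ (A δ) (B δ)
        {γ | ε / 2 ≤ (Real.log criticalFugacity - Real.log (X δ)) * (γ.length : ℝ)}).toReal := key
    _ < ε / 2 + ε / 2 := by
        have hδ' : (law Ω δ (A δ) (B δ)
            {γ | ε / 2 ≤ (Real.log criticalFugacity - Real.log (X δ)) * (γ.length : ℝ)}).toReal < ε / 2 := by
          simpa using hδ
        linarith
    _ = ε := add_halves ε

/-- **Left windows as wide as the critical length allows.** If `x_c - w(δ) ≤ X(δ) ≤ x_c` with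
`w(δ) ≤ x_c/2`, and `w(δ)|γ_δ| → 0` in `P_{x_c,δ}`-probability, then `X` is tilt-negligible
(`log x_c - log X ≤ 2w/x_c`). [folklore] -/
theorem isTiltNegligible_of_left_window {w X : ℝ → ℝ}
    (hX : ∀ᶠ δ in 𝓝[>] (0 : ℝ), criticalFugacity - w δ ≤ X δ ∧ X δ ≤ criticalFugacity)
    (hw : ∀ᶠ δ in 𝓝[>] (0 : ℝ), w δ ≤ criticalFugacity / 2)
    (hlen : ∀ ε : ℝ, 0 < ε → Tendsto (fun δ => law Ω δ (A δ) (B δ)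
        {γ | ε ≤ w δ * (γ.length : ℝ)}) (𝓝[>] 0) (𝓝 0)) :
    IsTiltNegligible X Ω A B := by
  obtain ⟨hxc, -⟩ := criticalFugacity_pos_lt_one'
  have hX' : ∀ᶠ δ in 𝓝[>] (0 : ℝ), 0 < X δ ∧ X δ ≤ criticalFugacity := by
    filter_upwards [hX, hw] with δ h₁ h₂
    exact ⟨by linarith [h₁.1], h₁.2⟩
  refine isTiltNegligible_of_left hX' fun ε hε => ?_
  -- `{ε ≤ t |γ|} ⊆ {ε x_c / 2 ≤ w |γ|}` eventually, since `t ≤ 2w/x_c`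
  have hsub : ∀ᶠ δ in 𝓝[>] (0 : ℝ),
      law Ω δ (A δ) (B δ) {γ | ε ≤ (Real.log criticalFugacity - Real.log (X δ)) * (γ.length : ℝ)} ≤
        law Ω δ (A δ) (B δ) {γ | ε * criticalFugacity / 2 ≤ w δ * (γ.length : ℝ)} := by
    filter_upwards [hX, hw] with δ h₁ h₂
    refine measure_mono fun γ hγ => ?_
    simp only [mem_setOf_eq] at hγ ⊢
    have hX2 : criticalFugacity / 2 ≤ X δ := by linarith [h₁.1]
    have ht : Real.log criticalFugacity - Real.log (X δ) ≤ w δ / (criticalFugacity / 2) := by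
      have h := abs_log_sub_log_le_div (half_pos hxc) hX2
        (by linarith : criticalFugacity / 2 ≤ criticalFugacity)
      calc Real.log criticalFugacity - Real.log (X δ)
          ≤ |Real.log criticalFugacity - Real.log (X δ)| := le_abs_self _
        _ ≤ |criticalFugacity - X δ| / (criticalFugacity / 2) := h
        _ ≤ w δ / (criticalFugacity / 2) := by
            refine div_le_div_of_nonneg_right ?_ (half_pos hxc).le
            rw [abs_of_nonneg (by linarith [h₁.2])]
            linarith [h₁.1]
    have hn : (0 : ℝ) ≤ γ.length := Nat.cast_nonneg _
    have h3 : ε ≤ w δ / (criticalFugacity / 2) * γ.length :=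
      hγ.trans (mul_le_mul_of_nonneg_right ht hn)
    have h4 : w δ / (criticalFugacity / 2) * γ.length = (w δ * γ.length) / (criticalFugacity / 2) := by
      ring
    rw [h4, le_div_iff₀ (half_pos hxc)] at h3
    linarith
  exact tendsto_of_tendsto_of_tendsto_of_le_of_le' tendsto_const_nhds
    (hlen (ε * criticalFugacity / 2) (by positivity)) (Eventually.of_forall fun _ => bot_le) hsub

/-- **LEFT windows are free up to the reciprocal scale of the critical length.** If in every
Dobrushin domain with an endpoint approximation `w(δ)|γ_δ| → 0` in probability under the
CRITICAL law, then along every schedule `x_c - w(δ) ≤ X(δ) ≤ x_c` the SLE_{8/3} statement is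
the sub-problem itself. (With `w = s δ²` the hypothesis is the zero density of the
critical walk — a theorem of `…DensityNecessary` under `SAWScalingLimit`, cf. the volume windows
of `…VolumeWindow`; with `w = s δ^{4/3}` it is the predicted tightness of `δ^{4/3}|γ_δ|`
[LSW04, Prediction 2], open; no unconditional bound better than `|γ_δ| ≤ |Ω_δ|` is known.)
[folklore] -/
theorem sawScalingLimitAlong_iff_of_left_window {w X : ℝ → ℝ}
    (hw : ∀ᶠ δ in 𝓝[>] (0 : ℝ), w δ ≤ criticalFugacity / 2)
    (hlen : ∀ (D : DobrushinDomain) (A B : ℝ → Site 2), IsEndpointApprox D A B → ∀ ε : ℝ, 0 < ε →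
      Tendsto (fun δ => law D.carrier δ (A δ) (B δ) {γ | ε ≤ w δ * (γ.length : ℝ)})
        (𝓝[>] 0) (𝓝 0))
    (hX : ∀ᶠ δ in 𝓝[>] (0 : ℝ), criticalFugacity - w δ ≤ X δ ∧ X δ ≤ criticalFugacity) :
    SAWScalingLimitAlong X ↔ SAWScalingLimit :=
  sawScalingLimitAlong_iff_of_isTiltNegligible fun D A B hAB =>
    isTiltNegligible_of_left_window hX hw (hlen D A B hAB)

/-- **Problem 10 along left windows.** Under the same tightness hypothesis in a bounded domain,
the fugacity-`X(δ)` walks, `x_c - w(δ) ≤ X(δ) ≤ x_c`, are weakly space-filling iff the critical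
walks are. [cite: DuminilCopinKozmaYadin2014, Problem 10] -/
theorem isSpaceFillingLaws_iff_of_left_window {w X : ℝ → ℝ} (hΩ : Bornology.IsBounded Ω)
    (hw : ∀ᶠ δ in 𝓝[>] (0 : ℝ), w δ ≤ criticalFugacity / 2)
    (hlen : ∀ ε : ℝ, 0 < ε → Tendsto (fun δ => law Ω δ (A δ) (B δ)
        {γ | ε ≤ w δ * (γ.length : ℝ)}) (𝓝[>] 0) (𝓝 0))
    (hX : ∀ᶠ δ in 𝓝[>] (0 : ℝ), criticalFugacity - w δ ≤ X δ ∧ X δ ≤ criticalFugacity) :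
    IsSpaceFillingLaws Ω A B (fun δ => lawAt (X δ) Ω δ (A δ) (B δ)) ↔
      IsSpaceFillingFamily criticalFugacity Ω A B :=
  (isTiltNegligible_of_left_window hX hw hlen).isSpaceFillingLaws_iff hΩ

end Left

/-! ### Schedules on either side: one exponential moment of the critical length -/

section ExpMoment

variable {Ω : Set ℂ} {A B : ℝ → Site 2}

/-- **Exponential-moment criterion (either side of `x_c`).** If the critical length has a
bounded exponential moment at rate `θ(δ) > 0`, `E_{x_c,δ}[e^{θ(δ)|γ_δ|}] ≤ K` for small `δ`,
and `|log X(δ) - log x_c| / θ(δ) → 0`, then the schedule `X` is tilt-negligible in `(Ω; A, B)`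
(bounded `Ω`): take `L = s/θ(δ)` in `integral_abs_fugacityTilt_sub_one_le_expMoment`, let
`δ → 0`, then `s → ∞`. [folklore] -/
theorem isTiltNegligible_of_expMoment {X θ : ℝ → ℝ} {K : ℝ} (hΩ : Bornology.IsBounded Ω)
    (hX : ∀ᶠ δ in 𝓝[>] (0 : ℝ), 0 < X δ) (hθ : ∀ᶠ δ in 𝓝[>] (0 : ℝ), 0 < θ δ)
    (hK : ∀ᶠ δ in 𝓝[>] (0 : ℝ), ∫ γ, Real.exp (θ δ * (γ.length : ℝ)) ∂law Ω δ (A δ) (B δ) ≤ K)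
    (ht : Tendsto (fun δ => |Real.log (X δ) - Real.log criticalFugacity| / θ δ) (𝓝[>] 0) (𝓝 0)) :
    IsTiltNegligible X Ω A B := by
  obtain ⟨hxc, -⟩ := criticalFugacity_pos_lt_one'
  refine ⟨hX, ?_⟩
  set K' : ℝ := max K 1 with hK'
  have hK'1 : 1 ≤ K' := le_max_right _ _
  have hK'0 : 0 < K' := lt_of_lt_of_le zero_lt_one hK'1
  rw [Metric.tendsto_nhds]
  intro ε hε
  -- `s > 0` with `2K' e^{-s/2} < ε/2`
  obtain ⟨s, hs0, hs⟩ : ∃ s : ℝ, 0 < s ∧ 2 * K' * Real.exp (-(s / 2)) < ε / 2 := by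
    have h1 : Tendsto (fun s : ℝ => 2 * K' * Real.exp (-(s / 2))) atTop (𝓝 (2 * K' * 0)) := by
      refine Tendsto.const_mul _ ?_
      have h2 : Tendsto (fun s : ℝ => s / 2) atTop atTop := tendsto_id.atTop_div_const (by norm_num)
      exact Real.tendsto_exp_neg_atTop_nhds_zero.comp h2
    rw [mul_zero] at h1
    obtain ⟨s, hs1, hs2⟩ :=
      ((h1.eventually (Iio_mem_nhds (half_pos hε))).and (eventually_gt_atTop 0)).exists
    exact ⟨s, hs2, hs1⟩
  -- `η > 0` with `e^η - 1 < ε/2`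
  obtain ⟨η, hη0, hη⟩ : ∃ η : ℝ, 0 < η ∧ Real.exp η - 1 < ε / 2 := by
    have h1 : Tendsto (fun η : ℝ => Real.exp η - 1) (𝓝[>] 0) (𝓝 (Real.exp 0 - 1)) :=
      ((Real.continuous_exp.tendsto 0).sub_const 1).mono_left nhdsWithin_le_nhds
    rw [Real.exp_zero, sub_self] at h1
    obtain ⟨η, hη1, hη2⟩ :=
      ((h1.eventually (Iio_mem_nhds (half_pos hε))).and self_mem_nhdsWithin).exists
    exact ⟨η, hη2, hη1⟩
  -- eventually `t/θ < min (1/2) (η/s)`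
  have hpos : (0 : ℝ) < min (1 / 2) (η / s) := lt_min (by norm_num) (div_pos hη0 hs0)
  have hsmall : ∀ᶠ δ in 𝓝[>] (0 : ℝ),
      |Real.log (X δ) - Real.log criticalFugacity| / θ δ < min (1 / 2) (η / s) :=
    ht.eventually (Iio_mem_nhds hpos)
  filter_upwards [hX, hθ, hK, hsmall, self_mem_nhdsWithin] with δ hXδ hθδ hKδ hδ hδ0
  rw [Real.dist_eq, sub_zero, abs_of_nonneg (tiltDefect_nonneg X Ω A B δ)]
  set t := |Real.log (X δ) - Real.log criticalFugacity| with htdef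
  have ht0 : 0 ≤ t := abs_nonneg _
  have ht1 : t / θ δ < 1 / 2 := hδ.trans_le (min_le_left _ _)
  have ht2 : t / θ δ < η / s := hδ.trans_le (min_le_right _ _)
  have htle : t ≤ θ δ / 2 := by
    rw [div_lt_iff₀ hθδ] at ht1; linarith
  have hts : t * s ≤ η * θ δ := by
    rw [div_lt_div_iff₀ hθδ hs0] at ht2; exact ht2.le
  set L : ℝ := s / θ δ with hLdef
  have hL0 : 0 ≤ L := (div_pos hs0 hθδ).le
  have hθL : θ δ * L = s := by rw [hLdef]; field_simp
  have hlen : ∀ γ : DomainSAW Ω δ (A δ) (B δ), γ.length ≤ (meshDomain Ω δ).ncard := fun γ =>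
    length_le_ncard_meshDomain (meshDomain_finite hΩ (mem_Ioi.1 hδ0)) γ
  have key := integral_abs_fugacityTilt_sub_one_le_expMoment (Ω := Ω) (δ := δ) (a := A δ) (b := B δ)
    hxc hXδ hlen (θ := θ δ) (L := L) (by linarith : t ≤ θ δ) hL0
  rw [lawAt_criticalFugacity] at key
  -- the three terms
  have e1 : Real.exp (L * t) - 1 ≤ Real.exp η - 1 := by
    refine sub_le_sub_right (Real.exp_le_exp.2 ?_) 1
    have : L * t = t * s / θ δ := by rw [hLdef]; ring
    rw [this, div_le_iff₀ hθδ]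
    exact hts
  have e2 : Real.exp (-((θ δ - t) * L)) ≤ Real.exp (-(s / 2)) := by
    rw [Real.exp_le_exp, neg_le_neg_iff]
    have h1 : θ δ / 2 * L ≤ (θ δ - t) * L := mul_le_mul_of_nonneg_right (by linarith) hL0
    have h2 : θ δ / 2 * L = s / 2 := by
      calc θ δ / 2 * L = θ δ * L / 2 := by ring
        _ = s / 2 := by rw [hθL]
    linarith
  have e3 : Real.exp (-(θ δ * L)) ≤ Real.exp (-(s / 2)) := by
    rw [Real.exp_le_exp, neg_le_neg_iff, hθL]
    linarith
  have hI : ∫ γ, Real.exp (θ δ * (γ.length : ℝ)) ∂law Ω δ (A δ) (B δ) ≤ K' :=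
    hKδ.trans (le_max_left _ _)
  have hI0 : 0 ≤ ∫ γ, Real.exp (θ δ * (γ.length : ℝ)) ∂law Ω δ (A δ) (B δ) :=
    integral_nonneg fun _ => (Real.exp_pos _).le
  calc tiltDefect X Ω A B δ
      ≤ (Real.exp (L * t) - 1) + (Real.exp (-((θ δ - t) * L)) + Real.exp (-(θ δ * L))) *
          ∫ γ, Real.exp (θ δ * (γ.length : ℝ)) ∂law Ω δ (A δ) (B δ) := key
    _ ≤ (Real.exp η - 1) + (Real.exp (-(s / 2)) + Real.exp (-(s / 2))) * K' :=
        add_le_add e1 (mul_le_mul (add_le_add e2 e3) hI hI0 (by positivity))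
    _ = (Real.exp η - 1) + 2 * K' * Real.exp (-(s / 2)) := by ring
    _ < ε / 2 + ε / 2 := add_lt_add hη hs
    _ = ε := add_halves ε

/-- **Windows on either side, under an exponential moment.** If `|X(δ) - x_c| ≤ w(δ) ≤ x_c/2`,
the critical length has `E_{x_c,δ}[e^{θ(δ)|γ_δ|}] ≤ K`, and `w(δ)/θ(δ) → 0`, then `X` is
tilt-negligible (`|log X - log x_c| ≤ 2w/x_c`). [folklore] -/
theorem isTiltNegligible_of_window_expMoment {w X θ : ℝ → ℝ} {K : ℝ} (hΩ : Bornology.IsBounded Ω)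
    (hX : ∀ᶠ δ in 𝓝[>] (0 : ℝ), |X δ - criticalFugacity| ≤ w δ)
    (hw : ∀ᶠ δ in 𝓝[>] (0 : ℝ), w δ ≤ criticalFugacity / 2)
    (hθ : ∀ᶠ δ in 𝓝[>] (0 : ℝ), 0 < θ δ)
    (hK : ∀ᶠ δ in 𝓝[>] (0 : ℝ), ∫ γ, Real.exp (θ δ * (γ.length : ℝ)) ∂law Ω δ (A δ) (B δ) ≤ K)
    (hwθ : Tendsto (fun δ => w δ / θ δ) (𝓝[>] 0) (𝓝 0)) :
    IsTiltNegligible X Ω A B := by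
  obtain ⟨hxc, -⟩ := criticalFugacity_pos_lt_one'
  have hX0 : ∀ᶠ δ in 𝓝[>] (0 : ℝ), 0 < X δ := by
    filter_upwards [hX, hw] with δ h₁ h₂
    have := neg_le_of_abs_le h₁
    linarith
  refine isTiltNegligible_of_expMoment hΩ hX0 hθ hK ?_
  have hup : ∀ᶠ δ in 𝓝[>] (0 : ℝ), |Real.log (X δ) - Real.log criticalFugacity| / θ δ ≤
      2 / criticalFugacity * (w δ / θ δ) := by
    filter_upwards [hX, hw, hθ] with δ h₁ h₂ h₃
    have hX2 : criticalFugacity / 2 ≤ X δ := by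
      have := neg_le_of_abs_le h₁; linarith
    have ht : |Real.log (X δ) - Real.log criticalFugacity| ≤ w δ / (criticalFugacity / 2) := by
      have h := abs_log_sub_log_le_div (half_pos hxc)
        (by linarith : criticalFugacity / 2 ≤ criticalFugacity) hX2
      exact h.trans (div_le_div_of_nonneg_right h₁ (half_pos hxc).le)
    calc |Real.log (X δ) - Real.log criticalFugacity| / θ δ ≤ (w δ / (criticalFugacity / 2)) / θ δ :=
          div_le_div_of_nonneg_right ht h₃.le
      _ = 2 / criticalFugacity * (w δ / θ δ) := by
          field_simp
  have hlow : ∀ᶠ δ in 𝓝[>] (0 : ℝ), 0 ≤ |Real.log (X δ) - Real.log criticalFugacity| / θ δ := by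
    filter_upwards [hθ] with δ h₃
    positivity
  have hlim : Tendsto (fun δ => 2 / criticalFugacity * (w δ / θ δ)) (𝓝[>] 0) (𝓝 0) := by
    simpa using hwθ.const_mul (2 / criticalFugacity)
  exact tendsto_of_tendsto_of_tendsto_of_le_of_le' tendsto_const_nhds hlim hlow hup

/-- **Along a schedule in such a window the SLE_{8/3} statement is the sub-problem.** [folklore] -/
theorem sawScalingLimitAlong_iff_of_window_expMoment {w X θ : ℝ → ℝ}
    (hX : ∀ᶠ δ in 𝓝[>] (0 : ℝ), |X δ - criticalFugacity| ≤ w δ)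
    (hw : ∀ᶠ δ in 𝓝[>] (0 : ℝ), w δ ≤ criticalFugacity / 2)
    (hθ : ∀ᶠ δ in 𝓝[>] (0 : ℝ), 0 < θ δ) (hwθ : Tendsto (fun δ => w δ / θ δ) (𝓝[>] 0) (𝓝 0))
    (hK : ∀ (D : DobrushinDomain) (A B : ℝ → Site 2), IsEndpointApprox D A B → ∃ K : ℝ,
      ∀ᶠ δ in 𝓝[>] (0 : ℝ), ∫ γ, Real.exp (θ δ * (γ.length : ℝ)) ∂law D.carrier δ (A δ) (B δ) ≤ K) :
    SAWScalingLimitAlong X ↔ SAWScalingLimit :=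
  sawScalingLimitAlong_iff_of_isTiltNegligible fun D A B hAB => by
    obtain ⟨K, hK'⟩ := hK D A B hAB
    exact isTiltNegligible_of_window_expMoment D.isBounded hX hw hθ hK' hwθ

/-- **TWO-SIDED windows are free up to the reciprocal rate of an exponential moment of the
critical length**: with `E_{x_c,δ}[e^{θ(δ)|γ_δ|}] ≤ K` in every Dobrushin domain with an endpoint
approximation and `w(δ)/θ(δ) → 0` (`0 ≤ w ≤ x_c/2`), the window-robust strengthening
`WindowRobustSAWScalingLimit w` is EQUIVALENT to the sub-problem. (With `θ = δ²` the moment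
bound is free, `|γ_δ| ≤ |Ω_δ| = O(δ⁻²)`, and one recovers the sub-volume windows `o(δ²)` of
`…Narrow`; `θ = δ^{4/3}` is the predicted scale.) [folklore] -/
theorem windowRobustSAWScalingLimit_iff_of_expMoment {w θ : ℝ → ℝ}
    (hw : ∀ᶠ δ in 𝓝[>] (0 : ℝ), 0 ≤ w δ ∧ w δ ≤ criticalFugacity / 2)
    (hθ : ∀ᶠ δ in 𝓝[>] (0 : ℝ), 0 < θ δ) (hwθ : Tendsto (fun δ => w δ / θ δ) (𝓝[>] 0) (𝓝 0))
    (hK : ∀ (D : DobrushinDomain) (A B : ℝ → Site 2), IsEndpointApprox D A B → ∃ K : ℝ,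
      ∀ᶠ δ in 𝓝[>] (0 : ℝ), ∫ γ, Real.exp (θ δ * (γ.length : ℝ)) ∂law D.carrier δ (A δ) (B δ) ≤ K) :
    WindowRobustSAWScalingLimit w ↔ SAWScalingLimit :=
  ⟨fun h => h.sawScalingLimit (hw.mono fun _ h => h.1),
    fun h _ hX => (sawScalingLimitAlong_iff_of_window_expMoment hX (hw.mono fun _ h => h.2)
      hθ hwθ hK).2 h⟩

/-- For the (zero-or-probability) SAW law, the integral of a function bounded by `C ≥ 0` is at
most `C`. [folklore] -/
theorem integral_lawAt_le_of_le {Ω : Set ℂ} {δ : ℝ} {a b : Site 2} (x : ℝ)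
    {f : DomainSAW Ω δ a b → ℝ} {C : ℝ} (hC : 0 ≤ C) (hf0 : ∀ γ, 0 ≤ f γ) (hf : ∀ γ, f γ ≤ C) :
    ∫ γ, f γ ∂lawAt x Ω δ a b ≤ C := by
  rcases lawAt_eq_zero_or_isProbabilityMeasure x Ω δ a b with h0 | hP
  · rw [h0, integral_zero_measure]; exact hC
  · haveI := hP
    have hint : Integrable f (lawAt x Ω δ a b) := integrable_lawAt_of_abs_le x f fun γ => by
      rw [abs_of_nonneg (hf0 γ)]; exact hf γ
    calc ∫ γ, f γ ∂lawAt x Ω δ a b ≤ ∫ _γ, C ∂lawAt x Ω δ a b := integral_mono hint (integrable_const C) hf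
      _ = C := by simp

/-- **The free exponential moment at the volume rate `θ = δ²`**: in a bounded domain
`E_{x_c,δ}[e^{δ²|γ_δ|}] ≤ e^{(2R+3)²}` for `0 < δ < 1`, `Ω ⊆ B̄(0, R)`, because
`|γ_δ| ≤ |Ω_δ| ≤ (2⌈R/δ⌉ + 1)² ≤ (2R+3)²/δ²`. [folklore] -/
theorem integral_exp_sq_mul_length_le {Ω : Set ℂ} {R : ℝ} (hR0 : 0 ≤ R) (hR : Ω ⊆ closedBall 0 R)
    (hΩ : Bornology.IsBounded Ω) {δ : ℝ} (hδ0 : 0 < δ) (hδ1 : δ < 1) (a b : Site 2) :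
    ∫ γ, Real.exp (δ ^ 2 * ((γ : DomainSAW Ω δ a b).length : ℝ)) ∂law Ω δ a b ≤
      Real.exp ((2 * R + 3) ^ 2) := by
  rw [← lawAt_criticalFugacity]
  have hN : ∀ γ : DomainSAW Ω δ a b, (γ.length : ℝ) ≤ (2 * R + 3) ^ 2 / δ ^ 2 := by
    intro γ
    have h1 : γ.length ≤ (2 * ⌈R / δ⌉₊ + 1) ^ 2 :=
      (length_le_ncard_meshDomain (meshDomain_finite hΩ hδ0) γ).trans (ncard_meshDomain_le hR hδ0)
    have h2 : (γ.length : ℝ) ≤ ((2 * ⌈R / δ⌉₊ + 1) ^ 2 : ℕ) := by exact_mod_cast h1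
    refine h2.trans ?_
    push_cast
    have h3 : ((⌈R / δ⌉₊ : ℕ) : ℝ) < R / δ + 1 := Nat.ceil_lt_add_one (by positivity)
    have h4 : (2 * ((⌈R / δ⌉₊ : ℕ) : ℝ) + 1) ≤ (2 * R + 3) / δ := by
      rw [le_div_iff₀ hδ0]
      have : R / δ * δ = R := div_mul_cancel₀ R hδ0.ne'
      nlinarith
    have h5 : (0 : ℝ) ≤ 2 * ((⌈R / δ⌉₊ : ℕ) : ℝ) + 1 := by positivity
    calc (2 * ((⌈R / δ⌉₊ : ℕ) : ℝ) + 1) ^ 2 ≤ ((2 * R + 3) / δ) ^ 2 := pow_le_pow_left₀ h5 h4 2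
      _ = (2 * R + 3) ^ 2 / δ ^ 2 := by rw [div_pow]
  refine integral_lawAt_le_of_le criticalFugacity (Real.exp_pos _).le (fun γ => (Real.exp_pos _).le)
    fun γ => ?_
  rw [Real.exp_le_exp]
  calc δ ^ 2 * (γ.length : ℝ) ≤ δ ^ 2 * ((2 * R + 3) ^ 2 / δ ^ 2) :=
        mul_le_mul_of_nonneg_left (hN γ) (sq_nonneg δ)
    _ = (2 * R + 3) ^ 2 := by field_simp

/-- **Consistency with `…Narrow`: the sub-volume windows `w = o(δ²)` are an instance of the
exponential-moment criterion** (rate `θ = δ²`, whose moment bound is free). [folklore] -/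
theorem windowRobustSAWScalingLimit_iff_of_tendsto_div_sq {w : ℝ → ℝ}
    (hw : ∀ᶠ δ in 𝓝[>] (0 : ℝ), 0 ≤ w δ ∧ w δ ≤ criticalFugacity / 2)
    (hw2 : Tendsto (fun δ => w δ / δ ^ 2) (𝓝[>] 0) (𝓝 0)) :
    WindowRobustSAWScalingLimit w ↔ SAWScalingLimit := by
  refine windowRobustSAWScalingLimit_iff_of_expMoment (θ := fun δ => δ ^ 2) hw ?_ hw2 fun D A B _ => ?_
  · filter_upwards [self_mem_nhdsWithin] with δ hδ using pow_pos (mem_Ioi.1 hδ) 2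
  · obtain ⟨R, hR0, hR⟩ : ∃ R, 0 ≤ R ∧ D.carrier ⊆ closedBall 0 R := by
      obtain ⟨R, hR⟩ := (Metric.isBounded_iff_subset_closedBall (0 : ℂ)).1 D.isBounded
      exact ⟨max R 0, le_max_right _ _, hR.trans (closedBall_subset_closedBall (le_max_left _ _))⟩
    refine ⟨Real.exp ((2 * R + 3) ^ 2), ?_⟩
    filter_upwards [Ioo_mem_nhdsGT (zero_lt_one' ℝ)] with δ hδ
    exact integral_exp_sq_mul_length_le hR0 hR D.isBounded hδ.1 hδ.2 (A δ) (B δ)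

end ExpMoment

end SupercriticalSAW

open SupercriticalSAW

/-- **Barrier `SupercriticalSAWSpaceFillingTiltWindow`** (thirty-first audit of `…Proofs`,
PROVED below): the free side of the near-critical window class of `SupercriticalSAWSpaceFilling`
(`evasions_known` (i): `O(δ²)` free by `…VolumeWindow`, `≥ δ^θ`, `θ < 1/4`, blocked by
`…WindowRateQuarter` / `…RightUniform`, in between "decided by no theorem") is the CRITICAL
LENGTH in disguise — (L) LEFT windows `x_c - w(δ) ≤ X(δ) ≤ x_c` are free as soon as
`w(δ)|γ_δ| → 0` in probability under the CRITICAL law (tightness of the length at scale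
`1/w(δ)`; the tilt of a left move is `≤ 1`), and (E) TWO-SIDED windows `|X(δ) - x_c| ≤ w(δ)`
are free as soon as the critical length has a bounded exponential moment at a rate `θ(δ)` with
`w(δ)/θ(δ) → 0`.

BARRIER (structured block, D-0021):
- technique_class: tilt-negligible fugacity schedules (`SupercriticalSAW.IsTiltNegligible`: `E_{x_c,δ}|(X(δ)/x_c)^{|γ_δ|} - 1| → 0`) — recorded as a barrier entry only to delimit the window class of the parent: this class is FREE, and it is delimited by the critical length alone [cite: DuminilCopinKozmaYadin2014, Theorem 1 and Problem 10]
- blocks: nothing — along a tilt-negligible schedule the fugacity-`X(δ)` laws and the critical laws are asymptotically equal in total variation (`SupercriticalSAW.IsTiltNegligible.tendsto_integral_sub`, `…tendsto_measureReal_sub`), so convergence in law to chordal SLE_κ for ANY `κ` (`SupercriticalSAW.IsTiltNegligible.convergesInLawToSLE_iff`), weak space-filling / Problem 10 (`…isSpaceFillingLaws_iff`) and every vanishing-probability conclusion (`…tendsto_measure_zero_iff`) are the same along `X` as at `x_c`, and `SAWScalingLimitAlong X ↔ SAWScalingLimit` (`SupercriticalSAW.sawScalingLimitAlong_iff_of_isTiltNegligible`);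 LEFT schedules are tilt-negligible under tightness alone (`SupercriticalSAW.isTiltNegligible_of_left`, `…_of_left_window`, `SupercriticalSAW.sawScalingLimitAlong_iff_of_left_window`), two-sided ones under one exponential moment (`SupercriticalSAW.isTiltNegligible_of_expMoment`, `…_of_window_expMoment`, `SupercriticalSAW.windowRobustSAWScalingLimit_iff_of_expMoment`), and the sub-volume class `o(δ²)` of `…Narrow` is the instance `θ = δ²`, whose moment bound is free (`SupercriticalSAW.windowRobustSAWScalingLimit_iff_of_tendsto_div_sq`) — all unconditional (axioms `propext`, `Classical.choice`, `Quot.sound`)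
- because: `P_{X(δ),δ}` is `P_{x_c,δ}` tilted by `ρ_δ = (X(δ)/x_c)^{|γ_δ|}` and `|∫ g dP_X - ∫ g dP_{x_c}| ≤ 4M · E_{x_c}|ρ_δ - 1|` once `E_{x_c}|ρ_δ - 1| ≤ 1/2` (`SupercriticalSAW.abs_integral_lawAt_sub_le_tiltDefect`: the `e^{N t}` prefactors of `…Narrow` / `…VolumeWindow` are not needed); for a LEFT move `ρ = e^{-t|γ|} ∈ (0, 1]`, so `E|ρ - 1| ≤ ε + P_{x_c}[t|γ_δ| ≥ ε]` (`SupercriticalSAW.integral_abs_fugacityTilt_sub_one_le_of_le`); in general `E|ρ - 1| ≤ (e^{Lt} - 1) + (e^{-(θ-t)L} + e^{-θL}) E_{x_c}[e^{θ|γ_δ|}]` (`SupercriticalSAW.integral_abs_fugacityTilt_sub_one_le_expMoment`), and `L = s/θ`, `δ → 0`, `s → ∞`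
- evasions_known: not applicable (free class). READING for planners: the undecided windows `δ² ≪ w(δ) ≲ δ^{1/4}` of the parent are not an independent door — on the LEFT they are exactly as free as the critical length is tight (`w(δ) = o(1/L(δ))` whenever `|γ_δ| = O_P(L(δ))` under `P_{x_c,δ}`; predicted `L = δ^{-4/3}` [cite: LawlerSchrammWerner2004SAW, Prediction 2], the finite-size variable `(β - β_c)L^{4/3}` lattice-side [cite: BradlyOwczarek2021, Abstract and §3]; unconditionally only `L = δ⁻²`, zero critical density itself being open, cf. `…Density` (xiv)), on the RIGHT as free as its exponential moments allow (large deviations of the critical length, the (LD) clause of `…Density`); AT the scale `w ≍ 1/L` itself the tilt `e^{∓ s L^{-1}|γ_δ|}` does not degenerate and robustness is expected to FAIL on both sides (a non-trivial reweighting of the critical limit by `e^{∓ s U}`, `U` the rescaled length — on the left the massive / off-critical regime [cite: MakarovSmirnov2010, Questions 4.12–4.13]), by no declaration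
- scope_caveats: bounded domains (every Dobrushin domain), any endpoints, `ℤ²`; the transfer is at the level of the lattice laws (total variation), so it needs no SLE input and covers every `κ` and every topology, but its hypotheses are on the CRITICAL law and are open beyond the volume scale: nothing here proves tightness of `δ^{4/3}|γ_δ|` or any exponential moment beyond `θ = δ²`; the converse (failure of robustness at `w ≍ 1/L`) is heuristic [cite: DuminilCopinKozmaYadin2014, Theorem 1 and Problem 10]
- status: established (proved in the tree: `SupercriticalSAWSpaceFillingTiltWindow_holds`)

[cite: DuminilCopinKozmaYadin2014, Theorem 1 and Problem 10] -/
def SupercriticalSAWSpaceFillingTiltWindow : Prop :=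
  (∀ w : ℝ → ℝ, (∀ᶠ δ in 𝓝[>] (0 : ℝ), w δ ≤ criticalFugacity / 2) →
    (∀ (D : DobrushinDomain) (A B : ℝ → Site 2), IsEndpointApprox D A B → ∀ ε : ℝ, 0 < ε →
      Tendsto (fun δ => law D.carrier δ (A δ) (B δ) {γ | ε ≤ w δ * (γ.length : ℝ)})
        (𝓝[>] 0) (𝓝 0)) →
    ∀ X : ℝ → ℝ, (∀ᶠ δ in 𝓝[>] (0 : ℝ), criticalFugacity - w δ ≤ X δ ∧ X δ ≤ criticalFugacity) →
      (SupercriticalSAW.SAWScalingLimitAlong X ↔ SAWScalingLimit)) ∧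
  (∀ w θ : ℝ → ℝ, (∀ᶠ δ in 𝓝[>] (0 : ℝ), 0 ≤ w δ ∧ w δ ≤ criticalFugacity / 2) →
    (∀ᶠ δ in 𝓝[>] (0 : ℝ), 0 < θ δ) → Tendsto (fun δ => w δ / θ δ) (𝓝[>] 0) (𝓝 0) →
    (∀ (D : DobrushinDomain) (A B : ℝ → Site 2), IsEndpointApprox D A B → ∃ K : ℝ,
      ∀ᶠ δ in 𝓝[>] (0 : ℝ),
        ∫ γ, Real.exp (θ δ * ((γ : DomainSAW D.carrier δ (A δ) (B δ)).length : ℝ))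
          ∂law D.carrier δ (A δ) (B δ) ≤ K) →
    (SupercriticalSAW.WindowRobustSAWScalingLimit w ↔ SAWScalingLimit))

/-- **The tilt-window entry holds.** [cite: DuminilCopinKozmaYadin2014, Theorem 1 and Problem 10] -/
theorem SupercriticalSAWSpaceFillingTiltWindow_holds : SupercriticalSAWSpaceFillingTiltWindow :=
  ⟨fun _ hw hlen _ hX => sawScalingLimitAlong_iff_of_left_window hw hlen hX,
    fun _ _ hw hθ hwθ hK => windowRobustSAWScalingLimit_iff_of_expMoment hw hθ hwθ hK⟩

end Literature.Barriers.CriticalPhenomena
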